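import Summits.NavierStokesRegularity.NavierStokesRegularity.Theorems.TypeILiouvilleTypeIliouvilleNoTypeIILpRateReach
import Mathlib.Analysis.SpecialFunctions.Pow.Integral
import Mathlib.Analysis.SpecialFunctions.ImproperIntegrals
import HarnessLib

/-!
# REACH for LORENTZ rates: `‖u(t)‖_{L^{q,∞}} ≤ C/(T − t)^{(1−3/q)/2}`, `3 < q < ∞`, already gives
# the sup-norm Type-I rate — and scaling stops exactly at `q = 3 = C2`
# (crux `TypeIliouvilleNoTypeII`, stmt-NavierStokesRegularity-0056; §B keep/kill calibration)

Helper file (theorems only).  `…LpRateReach.lean` (p456333) proved `(c_q) ⇒ (c_∞)` for the class of the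
hard core: a critical `L^q` RATE, `3 < q < ∞`, forces the pointwise Type-I rate, by scaling + Fatou
through the Type-II zoom.  This file weakens the hypothesis to the critical WEAK-`L^q` (Lorentz
`L^{q,∞}`) rate in distribution form,

  `vol{x : λ < ‖u(t, x)‖} ≤ (C (T − t)^{−a} / λ)^q`,  `a = (1 − 3/q)/2`,  all `λ > 0`, `t ∈ (t₁, T)`,

and reaches the same conclusion `IsTypeIBlowup u T` (`isTypeIBlowup_of_lorentzRate`,
`typeIliouvilleNoTypeII_of_lorentzRate`).  Mechanism: at a Type-II package centre the zoom slice
`w_k(0, y) = M_k⁻¹ u(t_k, x_k + (ν/M_k) y)` has distribution function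
`vol{λ < ‖w_k(0)‖} = (M_k/ν)³ vol{M_k λ < ‖u(t_k)‖} ≤ (β_k/λ)^q` with the SAME small factor
`β_k = M_k⁻¹ (M_k/ν)^{3/q} C (T − t_k)^{−a} ≤ C ν^{−3/q} (k²ν)^{−a} → 0` as in the `L^q` case
(`LpRateReach.zoomFactor_le`); a layer-cake bound on the unit ball
(`lintegral_enorm_sq_le_of_powTail`: tail `(β/λ)^q` beyond `λ₀ = β` ⇒ `∫_{B₁}‖w_k(0)‖² ≤ 2β²(|B₁| + 1/(q−2))`)
and Fatou on the ball give `∫_{B₁} ‖W(0)‖² = 0`, so the continuous limit vanishes near the origin —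
contradiction with `‖W(0,0)‖ ≥ 1/4`.  At `q = 3` the exponent `a` vanishes and `β_k` does not decay:
the weak-`L³` node C2 of the critics' REACH lattice is exactly where scaling stops (there the tree has
only the conditional `…WeakL3Reach.isTypeIBlowup_of_weakL3_of_liouvilleL`, modulo (L)).
Use (K2e REACH, by name): a §B candidate whose conclusion is a Lorentz rate `L^{q,∞}`, `q > 3`
(e.g. Barker–Prange-type quantitative statements), reaches C3 = 0056 in one line; since `L^q ⊂ L^{q,∞}`
this also re-derives p456333.  WHAT THIS IS NOT: not NS; nothing here bears on regularity or blow-up.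
[folklore]

References: Albritton–Barker 2019, §1 (`(c_p)`, Lemma 2.5 is stated for `L^{q,∞}_t L^{p,∞}_x`);
Koch–Nadirashvili–Seregin–Šverák 2009, §6; Grafakos, *Classical Fourier Analysis*, Prop. 1.4.9.
-/

noncomputable section

-- the summit and its single problem share the name `NavierStokesRegularity` (D-0017 nested layout)
set_option linter.dupNamespace false

open Set Function Filter Topology MeasureTheory Metric
open scoped NNReal ENNReal

namespace Summit.NavierStokesRegularity.NavierStokesRegularity.Theorems.TypeIliouvilleNoTypeII.LorentzRateReach

open Literature.Analysis Literature.Analysis.FluidPDE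
open Summit.NavierStokesRegularity.NavierStokesRegularity.Theorems.TypeIliouvilleNoTypeII.EternalProfile
open Summit.NavierStokesRegularity.NavierStokesRegularity.Theorems.TypeIliouvilleNoTypeII.LpRateReach

/-! ## Layer cake with a power tail -/

section LayerCake

variable {X : Type*} [MeasurableSpace X] {F : Type*} [NormedAddCommGroup F]

/-- **Layer-cake bound from a power tail of order `q > 2`.**  For any measure `μ`, any a.e.-strongly
measurable `f`, `M ≥ 0` and a threshold `λ₀ > 0`: if `μ{x : t < ‖f x‖} ≤ (M/t)^q` for all `t > λ₀`,
then `∫ ‖f‖² dμ ≤ 2 (μ(univ) λ₀² + M^q λ₀^{2−q}/(q − 2))` (split `∫‖f‖² = 2∫₀^∞ t μ{‖f‖ > t} dt` at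
`λ₀`; `∫_{λ₀}^∞ M^q t^{1−q} dt = M^q λ₀^{2−q}/(q−2)`). [cite: Grafakos2014, Prop. 1.4.9 and Ex. 1.1.11] -/
theorem lintegral_enorm_sq_le_of_powTail (μ : Measure X) {f : X → F} (hf : AEStronglyMeasurable f μ)
    {M lam0 q : ℝ} (hM : 0 ≤ M) (hlam0 : 0 < lam0) (hq : 2 < q)
    (htail : ∀ t : ℝ, lam0 < t → μ {x | t < ‖f x‖} ≤ ENNReal.ofReal ((M / t) ^ q)) :
    ∫⁻ x, ‖f x‖ₑ ^ 2 ∂μ ≤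
      ENNReal.ofReal 2 * (μ univ * ENNReal.ofReal (lam0 ^ 2) +
        ENNReal.ofReal (M ^ q * lam0 ^ (2 - q) / (q - 2))) := by
  have hint : ∫⁻ x, ‖f x‖ₑ ^ 2 ∂μ = ∫⁻ x, ENNReal.ofReal (‖f x‖ ^ (2 : ℝ)) ∂μ := by
    refine lintegral_congr fun x => ?_
    rw [Real.rpow_two, ENNReal.ofReal_pow (norm_nonneg _), ofReal_norm]
  have hnn : 0 ≤ᵐ[μ] fun x => ‖f x‖ := Eventually.of_forall fun x => norm_nonneg _
  have hmeas : AEMeasurable (fun x => ‖f x‖) μ := hf.norm.aemeasurable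
  rw [hint, lintegral_rpow_eq_lintegral_meas_lt_mul μ hnn hmeas (by norm_num : (0 : ℝ) < 2)]
  gcongr
  set g : ℝ → ℝ≥0∞ := fun t => μ {x | t < ‖f x‖} * ENNReal.ofReal (t ^ ((2 : ℝ) - 1)) with hg
  have hg1 : ∀ t : ℝ, 0 < t → g t = μ {x | t < ‖f x‖} * ENNReal.ofReal t := by
    intro t ht
    rw [hg]
    simp only
    rw [show (2 : ℝ) - 1 = 1 by norm_num, Real.rpow_one]
  have hsplit : Ioi (0 : ℝ) = Ioc 0 lam0 ∪ Ioi lam0 := (Ioc_union_Ioi_eq_Ioi hlam0.le).symm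
  rw [hsplit, lintegral_union measurableSet_Ioi Ioc_disjoint_Ioi_same]
  gcongr
  · calc ∫⁻ t in Ioc 0 lam0, g t
        ≤ ∫⁻ _ in Ioc 0 lam0, μ univ * ENNReal.ofReal lam0 := by
          refine setLIntegral_mono measurable_const fun t ht => ?_
          rw [hg1 t ht.1]
          exact mul_le_mul' (measure_mono (subset_univ _)) (ENNReal.ofReal_le_ofReal ht.2)
      _ = μ univ * ENNReal.ofReal (lam0 ^ 2) := by
          rw [setLIntegral_const, Real.volume_Ioc, sub_zero, mul_assoc, ← ENNReal.ofReal_mul hlam0.le,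
            pow_two]
  · have hle : ∀ t ∈ Ioi lam0, g t ≤ ENNReal.ofReal (M ^ q * t ^ (1 - q)) := by
      intro t ht
      have ht0 : 0 < t := hlam0.trans ht
      rw [hg1 t ht0]
      calc μ {x | t < ‖f x‖} * ENNReal.ofReal t
          ≤ ENNReal.ofReal ((M / t) ^ q) * ENNReal.ofReal t := mul_le_mul' (htail t ht) le_rfl
        _ = ENNReal.ofReal ((M / t) ^ q * t) := (ENNReal.ofReal_mul (by positivity)).symm
        _ = ENNReal.ofReal (M ^ q * t ^ (1 - q)) := by
            congr 1
            rw [Real.div_rpow hM ht0.le, Real.rpow_sub ht0, Real.rpow_one]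
            field_simp
    have hint2 : IntegrableOn (fun t : ℝ => M ^ q * t ^ (1 - q)) (Ioi lam0) volume :=
      (integrableOn_Ioi_rpow_of_lt (by linarith) hlam0).const_mul _
    calc ∫⁻ t in Ioi lam0, g t
        ≤ ∫⁻ t in Ioi lam0, ENNReal.ofReal (M ^ q * t ^ (1 - q)) :=
          setLIntegral_mono' measurableSet_Ioi hle
      _ = ENNReal.ofReal (∫ t in Ioi lam0, M ^ q * t ^ (1 - q)) := by
          rw [ofReal_integral_eq_lintegral_ofReal hint2]
          filter_upwards [ae_restrict_mem measurableSet_Ioi] with t ht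
          exact mul_nonneg (Real.rpow_nonneg hM q) (Real.rpow_nonneg (hlam0.trans ht).le _)
      _ = ENNReal.ofReal (M ^ q * lam0 ^ (2 - q) / (q - 2)) := by
          rw [integral_const_mul, integral_Ioi_rpow_of_lt (by linarith) hlam0]
          congr 1
          rw [show (1 : ℝ) - q + 1 = 2 - q by ring, mul_div_assoc, neg_div, ← div_neg, neg_sub]

end LayerCake

/-! ## The distribution function of the zoom slice -/

/-- **Distribution function of the centre slice of a window zoom.**  For `w = M⁻¹ • stPull (ν/M²)
(ν/M) t₀ x₀ u` and `λ > 0`: `vol{y : λ < ‖w(0, y)‖} = (M/ν)³ · vol{x : M λ < ‖u(t₀, x)‖}`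
(dilation by `ν/M`, translation by `x₀`, amplitude `M⁻¹`). [cite: Leray1934, §20] -/
theorem volume_superlevel_windowZoom_zero {ν M t₀ : ℝ} (hν : 0 < ν) (hM : 0 < M)
    {u : ℝ → EuclideanSpace ℝ (Fin 3) → EuclideanSpace ℝ (Fin 3)} (x₀ : EuclideanSpace ℝ (Fin 3))
    (lam : ℝ) :
    volume {y | lam < ‖(M⁻¹ • stPull (ν / M ^ 2) (ν / M) t₀ x₀ u) 0 y‖} =
      ENNReal.ofReal ((M / ν) ^ 3) * volume {x | M * lam < ‖u t₀ x‖} := by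
  have hγ : 0 < ν / M := div_pos hν hM
  set S : Set (EuclideanSpace ℝ (Fin 3)) := {x | M * lam < ‖u t₀ x‖} with hS
  have hset : {y | lam < ‖(M⁻¹ • stPull (ν / M ^ 2) (ν / M) t₀ x₀ u) 0 y‖} =
      (fun y : EuclideanSpace ℝ (Fin 3) => (ν / M) • y) ⁻¹' ((fun z => x₀ + z) ⁻¹' S) := by
    ext y
    simp only [mem_setOf_eq, mem_preimage, Pi.smul_apply, stPull_apply, mul_zero, add_zero, norm_smul,
      norm_inv, Real.norm_of_nonneg hM.le, hS]
    rw [← div_eq_inv_mul, lt_div_iff₀ hM, mul_comm]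
  rw [hset, Measure.addHaar_preimage_smul volume hγ.ne', measure_preimage_add, finrank_euclideanSpace_fin]
  congr 1
  rw [← inv_pow, inv_div, abs_of_pos (by positivity)]

/-! ## The reach theorem for Lorentz rates -/

/-- **A critical weak-`L^q` (Lorentz `L^{q,∞}`) rate, `3 < q < ∞`, forces the sup-norm Type-I rate.**
Hypotheses: the frame of the crux (`(u, p)` maximal smooth on `ℝ³ × [0, T)`, Leray–Hopf from a rapidly
decaying datum), `3 < q`, `C > 0`, and the Lorentz rate in distribution form
`vol{x : λ < ‖u(t, x)‖} ≤ (C (T − t)^{−(1−3/q)/2} / λ)^q` for all `λ > 0`, `t ∈ (t₁, T)`.  Conclusion: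
`IsTypeIBlowup u T`.  Proof: scaling + layer cake + Fatou through the Type-II zoom (module
docstring). [cite: AlbrittonBarker2019, §1 footnote p. 4 and Lemma 2.5 (arXiv:1811.00502)] -/
theorem isTypeIBlowup_of_lorentzRate (ν T : ℝ) (hν : 0 < ν) (hT : 0 < T)
    (u : ℝ → EuclideanSpace ℝ (Fin 3) → EuclideanSpace ℝ (Fin 3))
    (p : ℝ → EuclideanSpace ℝ (Fin 3) → ℝ) (hmax : IsMaximalSmoothSolution ν 0 u p T)
    (hLH : IsLerayHopfOn T ν 0 (u 0) u) (hdec : HasRapidSpatialDecay (u 0))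
    {q : ℝ} (hq : 3 < q) {C t₁ : ℝ} (hC : 0 < C) (ht₁ : t₁ < T)
    (hrate : ∀ t ∈ Ioo t₁ T, ∀ lam : ℝ, 0 < lam →
      volume {x | lam < ‖u t x‖} ≤
        ENNReal.ofReal ((C / (T - t) ^ ((1 - 3 / q) / 2) / lam) ^ q)) :
    IsTypeIBlowup u T := by
  by_contra hII
  obtain ⟨tc, xc, M, φ, W, hφ, hM, htI, hlate, hsig, -, -, -, hWs, -, -, -, h0, hval, -⟩ :=
    exists_eternalProfile_of_not_isTypeIBlowup ν T hν hT u p hmax hLH hdec hII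
  have hq2 : 2 < q := by linarith
  have hq0 : 0 < q := by linarith
  -- the zooms and their centre slices
  set w : ℕ → ℝ → EuclideanSpace ℝ (Fin 3) → EuclideanSpace ℝ (Fin 3) :=
    fun k => (M k)⁻¹ • stPull (ν / M k ^ 2) (ν / M k) (tc k) (xc k) u with hw
  have hcontu : ∀ k, Continuous (u (tc k)) := fun k =>
    (hmax.1.contDiff_velocity (htI k)).continuous
  have hcontw : ∀ k, Continuous (w k 0) := by
    intro k
    have e : w k 0 = (M k)⁻¹ • fun y => u (tc k) (xc k + (ν / M k) • y) := windowZoom_slice_zero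
    rw [e]
    have h1 : Continuous fun y : EuclideanSpace ℝ (Fin 3) => xc k + (ν / M k) • y :=
      continuous_const.add ((continuous_const (y := ν / M k)).smul continuous_id)
    exact ((hcontu k).comp h1).const_smul (M k)⁻¹
  -- the small factor `β_k`
  set b : ℕ → ℝ := fun k => C * ν ^ (-(3 / q)) * (((k : ℝ) ^ 2 * ν) ^ (-((1 - 3 / q) / 2))) with hb
  have hb0 : ∀ k, 1 ≤ k → 0 < b k := by
    intro k hk
    have hk0 : (0 : ℝ) < k := by exact_mod_cast hk
    have h1 : 0 < (k : ℝ) ^ 2 * ν := by positivity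
    rw [hb]
    exact mul_pos (mul_pos hC (Real.rpow_pos_of_pos hν _)) (Real.rpow_pos_of_pos h1 _)
  have hlateT : ∀ᶠ k : ℕ in atTop, t₁ < tc k ∧ 1 ≤ k := by
    have hTt₁ : 0 < T - t₁ := sub_pos.2 ht₁
    obtain ⟨N, hN⟩ := exists_nat_gt (1 / (T - t₁))
    refine (eventually_ge_atTop (max N 1)).mono fun k hk => ⟨?_, le_of_max_le_right hk⟩
    have hkN : (N : ℝ) ≤ k := by exact_mod_cast le_of_max_le_left hk
    have hk1 : (0 : ℝ) < (k : ℝ) + 1 := by positivity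
    have h1 : 1 / ((k : ℝ) + 1) < T - t₁ := by
      rw [div_lt_iff₀ hk1]
      have h2 : 1 < (T - t₁) * N := by
        have := (div_lt_iff₀ hTt₁).1 hN
        linarith
      nlinarith
    linarith [hlate k]
  -- the tail of the zoom slice: `vol{λ < ‖w_k(0)‖} ≤ (β_k/λ)^q`
  have htail : ∀ᶠ k : ℕ in atTop, ∀ lam : ℝ, 0 < lam →
      volume {y | lam < ‖w k 0 y‖} ≤ ENNReal.ofReal ((b k / lam) ^ q) := by
    filter_upwards [hlateT] with k hk lam hlam
    have hMk := hM k
    rw [hw, volume_superlevel_windowZoom_zero hν hMk (xc k) lam]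
    have h1 := hrate (tc k) ⟨hk.1, (htI k).2⟩ (M k * lam) (mul_pos hMk hlam)
    have hTt : 0 < T - tc k := sub_pos.2 (htI k).2
    set A : ℝ := C / (T - tc k) ^ ((1 - 3 / q) / 2) with hA
    have hA0 : 0 ≤ A := by rw [hA]; positivity
    calc ENNReal.ofReal ((M k / ν) ^ 3) * volume {x | M k * lam < ‖u (tc k) x‖}
        ≤ ENNReal.ofReal ((M k / ν) ^ 3) * ENNReal.ofReal ((A / (M k * lam)) ^ q) :=
          mul_le_mul' le_rfl h1
      _ = ENNReal.ofReal (((M k)⁻¹ * (M k / ν) ^ (3 / q) * A / lam) ^ q) := by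
          rw [← ENNReal.ofReal_mul (by positivity)]
          congr 1
          have hMν : (0 : ℝ) ≤ M k / ν := by positivity
          have h3 : ((M k / ν) ^ (3 / q)) ^ q = (M k / ν) ^ 3 := by
            rw [← Real.rpow_mul hMν, show 3 / q * q = (3 : ℝ) by field_simp,
              show (3 : ℝ) = ((3 : ℕ) : ℝ) by norm_num, Real.rpow_natCast]
          rw [Real.div_rpow (by positivity) hlam.le, Real.mul_rpow (by positivity) hA0,
            Real.mul_rpow (by positivity) (Real.rpow_nonneg hMν _), h3, Real.inv_rpow hMk.le,
            Real.div_rpow hA0 (by positivity), Real.mul_rpow hMk.le hlam.le]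
          have hMq : 0 < M k ^ q := Real.rpow_pos_of_pos hMk q
          have hlq : 0 < lam ^ q := Real.rpow_pos_of_pos hlam q
          field_simp
      _ ≤ ENNReal.ofReal ((b k / lam) ^ q) := by
          refine ENNReal.ofReal_le_ofReal (Real.rpow_le_rpow (by positivity) ?_ hq0.le)
          refine div_le_div_of_nonneg_right ?_ hlam.le
          exact zoomFactor_le hν hMk (htI k).2 hq hC.le hk.2 (hsig k)
  -- the `L²` bound on the unit ball: layer cake with threshold `β_k`
  set V : ℝ≥0∞ := volume (ball (0 : EuclideanSpace ℝ (Fin 3)) 1) with hV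
  have hVtop : V ≠ ⊤ := measure_ball_lt_top.ne
  have hball : ∀ᶠ k : ℕ in atTop, ∫⁻ y in ball 0 1, ‖w k 0 y‖ₑ ^ 2 ≤
      ENNReal.ofReal 2 * (V * ENNReal.ofReal (b k ^ 2) + ENNReal.ofReal (b k ^ 2 / (q - 2))) := by
    filter_upwards [htail, hlateT] with k hk hk1
    have hbk := hb0 k hk1.2
    have htail' : ∀ t : ℝ, b k < t →
        (volume.restrict (ball (0 : EuclideanSpace ℝ (Fin 3)) 1)) {y | t < ‖w k 0 y‖} ≤
          ENNReal.ofReal ((b k / t) ^ q) := by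
      intro t ht
      rw [Measure.restrict_apply' measurableSet_ball]
      exact (measure_mono inter_subset_left).trans (hk t (hbk.trans ht))
    have h1 := lintegral_enorm_sq_le_of_powTail (volume.restrict (ball (0 : EuclideanSpace ℝ (Fin 3)) 1))
      (hcontw k).aestronglyMeasurable.restrict hbk.le hbk hq2 htail'
    rw [Measure.restrict_apply_univ] at h1
    have hX : b k ^ q * b k ^ (2 - q) / (q - 2) = b k ^ 2 / (q - 2) := by
      rw [← Real.rpow_add hbk, show q + (2 - q) = (2 : ℝ) by ring, Real.rpow_two]
    rw [hX] at h1
    exact h1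
  -- the bound tends to zero along `φ`
  have hbφ : Tendsto (fun j => b (φ j)) atTop (𝓝 0) :=
    (tendsto_zoomBound_zero (C := C) hν hq).comp hφ.tendsto_atTop
  have hRHS : Tendsto (fun j => ENNReal.ofReal 2 * (V * ENNReal.ofReal (b (φ j) ^ 2) +
      ENNReal.ofReal (b (φ j) ^ 2 / (q - 2)))) atTop (𝓝 0) := by
    have h1 : Tendsto (fun j => b (φ j) ^ 2) atTop (𝓝 0) := by
      have := hbφ.pow 2
      rwa [zero_pow two_ne_zero] at this
    have h2 : Tendsto (fun j => ENNReal.ofReal (b (φ j) ^ 2)) atTop (𝓝 0) := by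
      have := ENNReal.tendsto_ofReal h1
      rwa [ENNReal.ofReal_zero] at this
    have h3 : Tendsto (fun j => ENNReal.ofReal (b (φ j) ^ 2 / (q - 2))) atTop (𝓝 0) := by
      have := ENNReal.tendsto_ofReal (h1.div_const (q - 2))
      rwa [zero_div, ENNReal.ofReal_zero] at this
    have h4 : Tendsto (fun j => V * ENNReal.ofReal (b (φ j) ^ 2)) atTop (𝓝 0) := by
      have := ENNReal.Tendsto.const_mul h2 (Or.inr hVtop)
      rwa [mul_zero] at this
    have h5 := h4.add h3
    rw [add_zero] at h5
    have h6 := ENNReal.Tendsto.const_mul (a := ENNReal.ofReal 2) h5 (Or.inr ENNReal.ofReal_ne_top)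
    rwa [mul_zero] at h6
  -- Fatou on the unit ball along `φ`
  have hmeasw : ∀ j, Measurable fun y => ‖w (φ j) 0 y‖ₑ ^ 2 := fun j =>
    (hcontw (φ j)).measurable.enorm.pow_const _
  have hlim : ∀ y, Tendsto (fun j => ‖w (φ j) 0 y‖ₑ ^ 2) atTop (𝓝 (‖W 0 y‖ₑ ^ 2)) := fun y =>
    ((ENNReal.continuous_pow 2).tendsto _).comp ((continuous_enorm.tendsto _).comp (hval 0 y))
  have hF : ∫⁻ y in ball 0 1, ‖W 0 y‖ₑ ^ 2 ≤
      atTop.liminf fun j => ∫⁻ y in ball (0 : EuclideanSpace ℝ (Fin 3)) 1, ‖w (φ j) 0 y‖ₑ ^ 2 := by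
    calc ∫⁻ y in ball 0 1, ‖W 0 y‖ₑ ^ 2
        = ∫⁻ y in ball (0 : EuclideanSpace ℝ (Fin 3)) 1, atTop.liminf fun j => ‖w (φ j) 0 y‖ₑ ^ 2 :=
          lintegral_congr fun y => ((hlim y).liminf_eq).symm
      _ ≤ atTop.liminf fun j => ∫⁻ y in ball (0 : EuclideanSpace ℝ (Fin 3)) 1, ‖w (φ j) 0 y‖ₑ ^ 2 :=
          lintegral_liminf_le hmeasw
  have hev : ∀ᶠ j in atTop, ∫⁻ y in ball (0 : EuclideanSpace ℝ (Fin 3)) 1, ‖w (φ j) 0 y‖ₑ ^ 2 ≤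
      ENNReal.ofReal 2 * (V * ENNReal.ofReal (b (φ j) ^ 2) + ENNReal.ofReal (b (φ j) ^ 2 / (q - 2))) :=
    hφ.tendsto_atTop.eventually hball
  have hlim0 : atTop.liminf (fun j => ∫⁻ y in ball (0 : EuclideanSpace ℝ (Fin 3)) 1, ‖w (φ j) 0 y‖ₑ ^ 2) = 0 := by
    refine le_antisymm ?_ bot_le
    calc atTop.liminf (fun j => ∫⁻ y in ball (0 : EuclideanSpace ℝ (Fin 3)) 1, ‖w (φ j) 0 y‖ₑ ^ 2)
        ≤ atTop.liminf (fun j => ENNReal.ofReal 2 * (V * ENNReal.ofReal (b (φ j) ^ 2) +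
            ENNReal.ofReal (b (φ j) ^ 2 / (q - 2)))) := liminf_le_liminf hev
      _ = 0 := hRHS.liminf_eq
  have hW0 : ∫⁻ y in ball (0 : EuclideanSpace ℝ (Fin 3)) 1, ‖W 0 y‖ₑ ^ 2 = 0 :=
    le_antisymm (hF.trans (le_of_eq hlim0)) bot_le
  -- `W(0, ·)` vanishes a.e. on the unit ball, hence at the origin by continuity
  have hWc : Continuous (W 0) := hWs.continuous.comp (Continuous.prodMk_right (0 : ℝ))
  have hae : ∀ᵐ y ∂(volume.restrict (ball (0 : EuclideanSpace ℝ (Fin 3)) 1)), ‖W 0 y‖ₑ ^ 2 = 0 :=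
    (lintegral_eq_zero_iff (hWc.measurable.enorm.pow_const _)).1 hW0
  have hae' : ∀ᵐ y ∂(volume.restrict (ball (0 : EuclideanSpace ℝ (Fin 3)) 1)), W 0 y = 0 := by
    filter_upwards [hae] with y hy
    have : ‖W 0 y‖ₑ = 0 := by
      rcases pow_eq_zero_iff two_ne_zero |>.1 hy with h
      exact h
    exact enorm_eq_zero.1 this
  have hW00 : W 0 0 = 0 := by
    -- a continuous function vanishing a.e. on the unit ball vanishes at its centre
    by_contra hne
    have hopen : IsOpen {y : EuclideanSpace ℝ (Fin 3) | W 0 y ≠ 0} := isOpen_ne_fun hWc continuous_const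
    obtain ⟨ε, hε, hsub⟩ := Metric.isOpen_iff.1 hopen 0 hne
    have hzero : volume ({y : EuclideanSpace ℝ (Fin 3) | ¬ W 0 y = 0} ∩ ball 0 1) = 0 := by
      rw [← Measure.restrict_apply' measurableSet_ball]
      exact ae_iff.1 hae'
    have hsub' : ball (0 : EuclideanSpace ℝ (Fin 3)) (min ε 1) ⊆
        {y : EuclideanSpace ℝ (Fin 3) | ¬ W 0 y = 0} ∩ ball 0 1 := fun y hy =>
      ⟨hsub (ball_subset_ball (min_le_left _ _) hy), ball_subset_ball (min_le_right _ _) hy⟩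
    have hpos : 0 < volume (ball (0 : EuclideanSpace ℝ (Fin 3)) (min ε 1)) :=
      measure_ball_pos volume _ (lt_min hε one_pos)
    exact absurd (measure_mono_null hsub' hzero) hpos.ne'
  rw [hW00, norm_zero] at h0
  linarith

/-- **`NoTypeII` from an a-priori critical LORENTZ-rate estimate** (`3 < q < ∞`; concluded BY NAME
for the hard core `Theses.TypeILiouville.TypeIliouvilleNoTypeII`): if every maximal classical solution
of unforced Navier–Stokes on `ℝ³ × [0,T)`, Leray–Hopf from a rapidly decaying datum, obeys
`‖u(t)‖_{L^{q,∞}} ≤ C/(T − t)^{(1−3/q)/2}` near `T` (distribution form) for some `q ∈ (3, ∞)`, `C > 0`,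
then every such blow-up is Type I — the REACH step (clause ⇒ C3) for every §B candidate typed as a
critical weak-`L^q` rate. [cite: AlbrittonBarker2019, §1 footnote p. 4 and Lemma 2.5 (arXiv:1811.00502)] -/
theorem typeIliouvilleNoTypeII_of_lorentzRate
    (hLq : ∀ (ν T : ℝ), 0 < ν → 0 < T →
      ∀ (u : ℝ → EuclideanSpace ℝ (Fin 3) → EuclideanSpace ℝ (Fin 3))
        (p : ℝ → EuclideanSpace ℝ (Fin 3) → ℝ),
      IsMaximalSmoothSolution ν 0 u p T → IsLerayHopfOn T ν 0 (u 0) u →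
      HasRapidSpatialDecay (u 0) →
      ∃ q C t₁ : ℝ, 3 < q ∧ 0 < C ∧ t₁ < T ∧ ∀ t ∈ Ioo t₁ T, ∀ lam : ℝ, 0 < lam →
        volume {x | lam < ‖u t x‖} ≤
          ENNReal.ofReal ((C / (T - t) ^ ((1 - 3 / q) / 2) / lam) ^ q)) :
    Summit.NavierStokesRegularity.NavierStokesRegularity.Theses.TypeILiouville.TypeIliouvilleNoTypeII := by
  intro ν T hν hT u p hmax hLH hdec
  obtain ⟨q, C, t₁, hq, hC, ht₁, hrate⟩ := hLq ν T hν hT u p hmax hLH hdec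
  exact isTypeIBlowup_of_lorentzRate ν T hν hT u p hmax hLH hdec hq hC ht₁ hrate

/-! ## The Lorentz rate subsumes the `L^q` rate -/

/-- **Chebyshev: an `L^q` bound is a weak-`L^q` bound**: `‖f‖_{L^q} ≤ A` (`A ≥ 0`, `0 < q < ∞`)
gives `μ{x : λ < ‖f x‖} ≤ (A/λ)^q` for every `λ > 0` (`mul_meas_ge_le_pow_eLpNorm'`). [folklore] -/
theorem measure_superlevel_le_of_eLpNorm_le {X : Type*} [MeasurableSpace X] (μ : Measure X)
    {F : Type*} [NormedAddCommGroup F] {f : X → F} (hf : AEStronglyMeasurable f μ)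
    {q A lam : ℝ} (hq : 0 < q) (hA : 0 ≤ A) (hlam : 0 < lam)
    (hbd : eLpNorm f (ENNReal.ofReal q) μ ≤ ENNReal.ofReal A) :
    μ {x | lam < ‖f x‖} ≤ ENNReal.ofReal ((A / lam) ^ q) := by
  have hq0 : ENNReal.ofReal q ≠ 0 := (ENNReal.ofReal_pos.2 hq).ne'
  have hqr : (ENNReal.ofReal q).toReal = q := ENNReal.toReal_ofReal hq.le
  have h1 := mul_meas_ge_le_pow_eLpNorm' (μ := μ) hq0 ENNReal.ofReal_ne_top hf (ENNReal.ofReal lam)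
  rw [hqr] at h1
  have hsub : {x | lam < ‖f x‖} ⊆ {x | ENNReal.ofReal lam ≤ ‖f x‖ₑ} := by
    intro x hx
    have hx' : lam < ‖f x‖ := hx
    show ENNReal.ofReal lam ≤ ‖f x‖ₑ
    rw [← ofReal_norm]
    exact ENNReal.ofReal_le_ofReal hx'.le
  have hεq : (ENNReal.ofReal lam) ^ q = ENNReal.ofReal (lam ^ q) :=
    ENNReal.ofReal_rpow_of_pos hlam
  have hε0 : (ENNReal.ofReal lam) ^ q ≠ 0 := by
    rw [hεq]; exact (ENNReal.ofReal_pos.2 (Real.rpow_pos_of_pos hlam q)).ne'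
  have hεtop : (ENNReal.ofReal lam) ^ q ≠ ⊤ := by rw [hεq]; exact ENNReal.ofReal_ne_top
  have h2 : μ {x | ENNReal.ofReal lam ≤ ‖f x‖ₑ} ≤
      eLpNorm f (ENNReal.ofReal q) μ ^ q / (ENNReal.ofReal lam) ^ q := by
    rw [ENNReal.le_div_iff_mul_le (Or.inl hε0) (Or.inl hεtop), mul_comm]
    exact h1
  calc μ {x | lam < ‖f x‖} ≤ μ {x | ENNReal.ofReal lam ≤ ‖f x‖ₑ} := measure_mono hsub
    _ ≤ eLpNorm f (ENNReal.ofReal q) μ ^ q / (ENNReal.ofReal lam) ^ q := h2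
    _ ≤ ENNReal.ofReal A ^ q / (ENNReal.ofReal lam) ^ q := by
        gcongr
    _ = ENNReal.ofReal ((A / lam) ^ q) := by
        rw [ENNReal.ofReal_rpow_of_nonneg hA hq.le, hεq, Real.div_rpow hA hlam.le,
          ENNReal.ofReal_div_of_pos (Real.rpow_pos_of_pos hlam q)]

/-- **`D_q ⇒ D_{q,∞}`: the critical `L^q`-rate clause of `…LpRateReach.lean` implies the critical
LORENTZ-rate clause of this file** (constant `C + 1`, times `t > max t₁ 0`), by Chebyshev — so
`isTypeIBlowup_of_lorentzRate` subsumes `LpRateReach.isTypeIBlowup_of_lqRate` (p456333) as a REACH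
instrument. [cite: AlbrittonBarker2019, §1 footnote p. 4 (arXiv:1811.00502)] -/
theorem lorentzRate_of_lqRate {ν T : ℝ} {u : ℝ → EuclideanSpace ℝ (Fin 3) → EuclideanSpace ℝ (Fin 3)}
    {p : ℝ → EuclideanSpace ℝ (Fin 3) → ℝ} (hcl : IsClassicalNSSolutionOn (Ico 0 T) ν 0 u p)
    {q C t₁ : ℝ} (hq : 0 < q) (hC : 0 ≤ C)
    (hrate : ∀ t ∈ Ioo t₁ T,
      eLpNorm (u t) (ENNReal.ofReal q) volume ≤ ENNReal.ofReal (C / (T - t) ^ ((1 - 3 / q) / 2))) :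
    ∀ t ∈ Ioo (max t₁ 0) T, ∀ lam : ℝ, 0 < lam →
      volume {x | lam < ‖u t x‖} ≤
        ENNReal.ofReal (((C + 1) / (T - t) ^ ((1 - 3 / q) / 2) / lam) ^ q) := by
  intro t ht lam hlam
  have ht' : t ∈ Ioo t₁ T := ⟨(le_max_left _ _).trans_lt ht.1, ht.2⟩
  have ht0 : t ∈ Ico 0 T := ⟨(le_max_right _ _).trans ht.1.le, ht.2⟩
  have hTt : 0 < T - t := sub_pos.2 ht.2
  have hmeas : AEStronglyMeasurable (u t) volume :=
    (hcl.contDiff_velocity ht0).continuous.aestronglyMeasurable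
  have hA : 0 ≤ (C + 1) / (T - t) ^ ((1 - 3 / q) / 2) := by positivity
  refine measure_superlevel_le_of_eLpNorm_le volume hmeas hq hA hlam ((hrate t ht').trans ?_)
  exact ENNReal.ofReal_le_ofReal (div_le_div_of_nonneg_right (by linarith)
    (Real.rpow_nonneg hTt.le _))

end Summit.NavierStokesRegularity.NavierStokesRegularity.Theorems.TypeIliouvilleNoTypeII.LorentzRateReach

end
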